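import Summits.BirchSwinnertonDyer.Rank1Residual.X5.TwoAdicTargetsTowerGap
import HarnessLib

/-!
# LAYER BLINDNESS of the TOWER road: `(T^c + p·u, ω_n) = (p, ω_n) = (p, T^{pⁿ})` once `c ≥ pⁿ`
# (route ByReductionTypeAtTwo, crux `OrdKatoHalfAtTwoIso` 19573 / `OrdKatoHalfAtTwo` 19271; seat
# bsd-2adic-ord-2 GEN 5, MEMO-3 §2) — a typed OBSTRUCTION, pure algebra over `Λ = ℤ_p⟦T⟧`, any `p`

HONEST FRAMING (cell `bsd-2adic`, run/shared/lean/pub/bsd-2adic/, HUMAN RULINGS D-0036 / D-0054 / D-0074):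
THEOREMS ONLY; nothing asserted; no definition; no named fact; closes nothing and refutes nothing.
What it records: the two torsion `Λ`-modules
* `X₁ = Λ/(T^c + p·u)` (`u` a unit; `μ = 0`, `λ = c`: a free `ℤ_p`-module of rank `c`, `X₁/pX₁ ≅ 𝔽_p[T]/T^c`
  one cyclic factor of length `c`), and
* `X₂ = Λ/(p)` (`μ = 1`, `λ = 0`: `𝔽_p⟦T⟧`, not finitely generated over `ℤ_p`)
have THE SAME layer quotient `Xᵢ/ω_nXᵢ = Λ/(p, T^{pⁿ})` for every `n` with `pⁿ ≤ c`
(`span_XPowAddCMul_sup_span_omega_eq_towerIdeal` + the tree's `span_C_p_sup_span_omega_eq_towerIdeal`).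
Since every datum the per-class TOWER certificates read at layer `n` (the layer Selmer group
`Sel_{p^∞}(E/K_n)`, the group `A_n = h_n⁻¹(Sel_∞)`, their `p^k`-torsion counts, the `Γ/Γ_n`-action) is a
functor of `X/ω_nX` (control; tree `TowerLayer.natCard_quotient_towerIdeal_eq_natCard_layerClasses`), NO
certificate built from layers `n` with `pⁿ ≤ c` — no count gap at any pair `(j, j')` with `p^{j'} ≤ c`, no
`m = 0` door, no nilpotency or free-summand test, no `p^k`-level refinement — separates a class whose
`X/pX` has a cyclic `𝔽_p⟦T⟧`-factor of length `c ≥ pⁿ` from a `μ = 1` class. At `p = 2` this is why the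
38 irreducible good-ordinary X5 classes with `e₃ − e₂ = 4 = 2³ − 2²` (ord-2 MEMO-3 §3 (a)) need the layer
`ℚ_4 = ℚ(ζ₆₄)⁺` (or an input that is not a function of `X/ω_{≤3}`), and why GEN 2's level-one door,
GEN 3's `(·,2)` pairs, GEN 5's `(·,3)` pairs and the `(·,4)` pairs form a strictly increasing chain.
References: [GreenbergLNM1716] §1 p. 60, §3 pp. 85–91; [Washington1997] §13.2 (Prop. 13.8, Lemma 13.10).
-/

set_option autoImplicit false
-- the route's Theorems namespace repeats a component by design (summit = sub-problem, D-0017).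
set_option linter.dupNamespace false

noncomputable section

open Literature.NumberTheory.EllipticCurves Summit.BirchSwinnertonDyer.Rank1Residual.X5.TowerGap

namespace Summit.BirchSwinnertonDyer.BirchSwinnertonDyer.Theorems.KatoHalfPinch

variable (p : ℕ) [hp : Fact p.Prime]

/-- `ω_n(0) = 0`: the constant coefficient of `(1+T)^{pⁿ} − 1` vanishes. [folklore] -/
theorem constantCoeff_omega (n : ℕ) : PowerSeries.constantCoeff (omega p n) = 0 := by
  simp [omega]

/-- **`T^{pⁿ} = a·p + b·ω_n` with `a(0) = 0`** (from `(p, ω_n) = (p, T^{pⁿ})`, comparing constant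
coefficients: `0 = a(0)·p + b(0)·ω_n(0) = a(0)·p` in the domain `ℤ_p`). [cite: Washington1997, §13.2] -/
theorem exists_X_pow_eq_mul_C_p_add_mul_omega (n : ℕ) :
    ∃ a b : IwasawaAlgebra p, (PowerSeries.X : IwasawaAlgebra p) ^ p ^ n =
      a * PowerSeries.C (p : ℤ_[p]) + b * omega p n ∧ PowerSeries.constantCoeff a = 0 := by
  have hmem : (PowerSeries.X : IwasawaAlgebra p) ^ p ^ n ∈
      Ideal.span {(PowerSeries.C (p : ℤ_[p]) : IwasawaAlgebra p)} ⊔ Ideal.span {omega p n} := by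
    rw [span_C_p_sup_span_omega_eq_towerIdeal, towerIdeal_eq_span_pair]
    exact Ideal.subset_span (by simp)
  obtain ⟨y, hy, z, hz, hyz⟩ := Submodule.mem_sup.mp hmem
  obtain ⟨a, rfl⟩ := Ideal.mem_span_singleton'.mp hy
  obtain ⟨b, rfl⟩ := Ideal.mem_span_singleton'.mp hz
  refine ⟨a, b, hyz.symm, ?_⟩
  -- constant coefficients: `0 = a(0)·p + b(0)·0`
  have h0 := congrArg PowerSeries.constantCoeff hyz
  simp only [map_add, map_mul, PowerSeries.constantCoeff_C, constantCoeff_omega, mul_zero, add_zero,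
    map_pow, PowerSeries.constantCoeff_X] at h0
  rw [zero_pow (pow_ne_zero _ hp.out.ne_zero)] at h0
  rcases mul_eq_zero.mp h0 with ha | hpz
  · exact ha
  · exact absurd hpz (by exact_mod_cast hp.out.ne_zero : ((p : ℕ) : ℤ_[p]) ≠ 0)

/-- **LAYER BLINDNESS: `(T^c + p·u) + (ω_n) = (p, T^{pⁿ})` for `c ≥ pⁿ` and `u ∈ Λˣ`.** So the
`μ = 0` module `Λ/(T^c + p·u)` (`λ = c`) and the `μ = 1` module `Λ/(p)` have the SAME quotient
`Λ/(p, T^{pⁿ})` modulo `ω_n` — every layer-`n` datum with `pⁿ ≤ c` agrees on them. Proof: `⊆` is clear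
(`T^c = T^{c−pⁿ}·T^{pⁿ}`, `ω_n ∈ (p, ω_n)`); for `⊇`, write `T^{pⁿ} = a p + b ω_n` with `a(0) = 0`; then
`p·(u + T^{c−pⁿ} a) = (T^c + p u) − T^{c−pⁿ} b ω_n` lies in the left side and `u + T^{c−pⁿ}a` is a unit
(constant coefficient `u(0)`), so `p`, hence `T^{pⁿ}`, lies in the left side.
[cite: Washington1997, §13.2 (Prop. 13.8, Lemma 13.10)] [cite: GreenbergLNM1716, §3 pp. 85–91] -/
theorem span_XPowAddCMul_sup_span_omega_eq_towerIdeal (n c : ℕ) (hc : p ^ n ≤ c)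
    (u : (IwasawaAlgebra p)ˣ) :
    Ideal.span {(PowerSeries.X : IwasawaAlgebra p) ^ c + PowerSeries.C (p : ℤ_[p]) * (u : IwasawaAlgebra p)} ⊔
        Ideal.span {omega p n} = towerIdeal p (p ^ n) := by
  set P : IwasawaAlgebra p := PowerSeries.C (p : ℤ_[p]) with hP
  set f : IwasawaAlgebra p := PowerSeries.X ^ c + P * (u : IwasawaAlgebra p) with hf
  apply le_antisymm
  · -- `⊆`
    rw [← span_C_p_sup_span_omega_eq_towerIdeal]
    refine sup_le (Ideal.span_le.mpr (Set.singleton_subset_iff.mpr ?_)) le_sup_right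
    have hX : (PowerSeries.X : IwasawaAlgebra p) ^ c ∈
        Ideal.span {P} ⊔ Ideal.span {omega p n} := by
      rw [span_C_p_sup_span_omega_eq_towerIdeal]
      refine towerIdeal_anti p hc ?_
      rw [towerIdeal_eq_span_pair]
      exact Ideal.subset_span (by simp)
    exact Submodule.add_mem _ hX
      (Submodule.mem_sup_left (Ideal.mul_mem_right _ _ (Ideal.mem_span_singleton_self _)))
  · -- `⊇`: first `p ∈ (f) + (ω_n)`
    obtain ⟨a, b, hab, ha0⟩ := exists_X_pow_eq_mul_C_p_add_mul_omega p n
    set J : Ideal (IwasawaAlgebra p) := Ideal.span {f} ⊔ Ideal.span {omega p n} with hJ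
    have hfJ : f ∈ J := Submodule.mem_sup_left (Ideal.mem_span_singleton_self _)
    have hωJ : omega p n ∈ J := Submodule.mem_sup_right (Ideal.mem_span_singleton_self _)
    -- the unit `v = u + T^{c−pⁿ}·a`
    set v : IwasawaAlgebra p := (u : IwasawaAlgebra p) + PowerSeries.X ^ (c - p ^ n) * a with hv
    have hvunit : IsUnit v := by
      rw [PowerSeries.isUnit_iff_constantCoeff]
      have : PowerSeries.constantCoeff v = PowerSeries.constantCoeff (u : IwasawaAlgebra p) := by
        simp [hv, ha0]
      rw [this]
      exact (PowerSeries.isUnit_iff_constantCoeff.mp u.isUnit)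
    -- `P * v = f − T^{c−pⁿ}·b·ω_n`
    have hPv : P * v = f - PowerSeries.X ^ (c - p ^ n) * b * omega p n := by
      have hsplit : (PowerSeries.X : IwasawaAlgebra p) ^ c = PowerSeries.X ^ (c - p ^ n) * PowerSeries.X ^ p ^ n := by
        rw [← pow_add, Nat.sub_add_cancel hc]
      rw [hv, hf, hsplit, hab]; ring
    have hPvJ : P * v ∈ J := by
      rw [hPv]
      exact Submodule.sub_mem _ hfJ (Ideal.mul_mem_left _ _ hωJ)
    have hPJ : P ∈ J := by
      obtain ⟨w, hw⟩ := hvunit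
      have : P = P * v * (↑w⁻¹ : IwasawaAlgebra p) := by rw [← hw, mul_assoc, Units.mul_inv, mul_one]
      rw [this]
      exact Ideal.mul_mem_right _ _ hPvJ
    -- hence `(p, ω_n) ≤ J`
    rw [← span_C_p_sup_span_omega_eq_towerIdeal]
    exact sup_le ((Ideal.span_singleton_le_iff_mem _).mpr (by simpa only [hJ] using hPJ)) le_sup_right

/-- **The two modules agree modulo `ω_n`**: `(T^c + p·u) + (ω_n) = (p) + (ω_n)` for `pⁿ ≤ c` — the
layer-`n` quotients of `Λ/(T^c + p u)` (`μ = 0`, `λ = c`) and of `Λ/(p)` (`μ = 1`) are the same ring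
`Λ/(p, T^{pⁿ})`. [cite: Washington1997, §13.2] -/
theorem span_XPowAddCMul_sup_span_omega_eq_span_C_p_sup_span_omega (n c : ℕ) (hc : p ^ n ≤ c)
    (u : (IwasawaAlgebra p)ˣ) :
    Ideal.span {(PowerSeries.X : IwasawaAlgebra p) ^ c + PowerSeries.C (p : ℤ_[p]) * (u : IwasawaAlgebra p)} ⊔
        Ideal.span {omega p n} =
      Ideal.span {(PowerSeries.C (p : ℤ_[p]) : IwasawaAlgebra p)} ⊔ Ideal.span {omega p n} := by
  rw [span_XPowAddCMul_sup_span_omega_eq_towerIdeal p n c hc u, span_C_p_sup_span_omega_eq_towerIdeal]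

/-- **At `p = 2`, `n = 3`**: for every `c ≥ 8` and unit `u`, `(T^c + 2u, ω₃) = (2, ω₃) = (2, T⁸)` — the
layer `ℚ_3 = ℚ(ζ₃₂)⁺` (and a fortiori `ℚ_0, ℚ_1, ℚ_2`) cannot tell `Λ/(T^c + 2u)` from `Λ/(2)`.
[cite: GreenbergLNM1716, §3 pp. 85–91] -/
theorem span_XPowAddTwoMul_sup_span_omega_three_eq (c : ℕ) (hc : 8 ≤ c) (u : (IwasawaAlgebra 2)ˣ) :
    Ideal.span {(PowerSeries.X : IwasawaAlgebra 2) ^ c + PowerSeries.C (2 : ℤ_[2]) * (u : IwasawaAlgebra 2)} ⊔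
        Ideal.span {omega 2 3} = towerIdeal 2 8 := by
  have h := span_XPowAddCMul_sup_span_omega_eq_towerIdeal 2 3 c (by norm_num; exact hc) u
  norm_num at h
  exact h

end Summit.BirchSwinnertonDyer.BirchSwinnertonDyer.Theorems.KatoHalfPinch

end
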